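import Summits.BirchSwinnertonDyer.Rank1Residual.GaloisImage.KolyvaginFiniteSingularTorsionPrelims
import Summits.BirchSwinnertonDyer.Rank1Residual.GaloisImage.CyclotomicLevelInertiaGenerators
import HarnessLib

/-!
# Generators `σ_ℓ` of the cyclotomic levels over `ℚ` in the inertia groups, with prescribed
# characters mod `Nℓ = absNorm ℓ` — the currency of `KolyvaginDatum.HasCanonicalComparison`
# (cell `b2b-bsdres`, n1011 p11 GEN 10; row T-DER, THEOREM D file D1; E4a
# `CyclotomicLevelInertiaGenerators` in the datum's currency)

HONEST FRAMING (cell `b2b-bsdres`, run/shared/lean/b2b/bsd-rank1-residual/, verbatim in every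
file): the goal of the cell is to DELETE the COMBINATION-SHAPED residual classes of the
Birch–Swinnerton-Dyer formula for ALL analytic-rank `≤ 1` elliptic curves over `ℚ` — "full BSD
formula for every rank `≤ 1` curve in class `C`" assembled STRICTLY from published theorems — so
that the rank-`≤ 1` remainder becomes exactly the CONSTRUCTION-SHAPED classes, which are TYPED
(missing-input `Prop`s), NOT attempted. This is not "finishing BSD". Team n1011: research route on
the CONSTRUCTION-SHAPED class X4 / §I N11 (route-1 PORT, (P-DER)); TOOL theorem of Galois theory
(curve-free); no definition, no named fact, no `sorry`.

## What

A Kolyvagin datum with the canonical comparison maps (`D.HasCanonicalComparison N η`, tree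
`FiniteSingularComparison.lean`) fixes, at every `ℓ ∈ 𝒫`, a primitive root
`η_ℓ ∈ (ℤ/Nℓ)ˣ`, `Nℓ = absNorm ℓ` (Kim, §2.2.2: "the choice of generators of `Gal(ℚ(μ_ℓ)/ℚ)` …
corresponds to the choice of the primitive roots").  ROW T-DER's derivative classes are built from
generators `σ_ℓ ∈ Γ_ℚ` (THEOREM A/C binders `hσ hcov hinj`, `hσI`), and the `fs_rel` assembly (C5b-β
`Derivative.Rat.singularLocalization_eq_fsLocalization_of_eulerSystem`) wants
`χ_{Nℓ}(σ_ℓ) = η_ℓ` with `σ_ℓ ∈ I_{𝔓₀(ℓ)}`, `𝔓₀(ℓ) = adicCompletionPrime ℚ ℓ`.  This file chooses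
ONE `σ` for ALL finite places at once, in that currency:
`Rat.exists_sigma_mem_inertia_absNorm` — given primes `𝔔_ℓ ∣ ℓ` of `ℤ̄` and units
`η_ℓ ∈ (ℤ/Nℓ)ˣ`, there is `σ` with `σ_ℓ ∈ I_{𝔔_ℓ}` and `χ_{Nℓ}(σ_ℓ) = η_ℓ` for every `ℓ` (C5b-β′
`exists_mem_inertia_modNCyclotomicCharacter_absNorm_eq`), hence `σ_ℓ` in every tame level
`Gal(ℚ̄/ℚ(μ_{q′}))`, `q ≠ ℓ`, and every `p`-level, `ℓ′ ≠ p` (E4a); and at every `ℓ` where `η_ℓ`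
GENERATES `(ℤ/Nℓ)ˣ` the powers `σ_ℓ^j`, `j < ℓ′ − 1`, represent `Γ_ℚ / Gal(ℚ̄/ℚ(μ_{ℓ′}))` exactly
once (T-DER-INST `existsUnique_pow_inv_mul_mem_rootsOfUnityFixer` at `N = Nℓ`, and `Nℓ = ℓ′`, tree
`LFunctions.absNorm_asIdeal_eq_primesEquiv`).
0 defs, 0 facts.  References (context): K. Rubin, *Euler Systems* (2000) §4.4; K. Rubin, PCMI 18
(2011), Def. 1.9.4; C.-H. Kim, arXiv:2203.12159, §2.2.2; J. Neukirch, *ANT*, Ch. I (10.3)–(10.4).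
-/

noncomputable section

open Field IsDedekindDomain
open scoped NumberField
open Literature.NumberTheory.GaloisRepresentations

namespace Summit.BirchSwinnertonDyer.Rank1Residual.GaloisImage.CyclotomicLevel.Rat

open Rat.HeightOneSpectrum

/-- `#(ℤ/Nℓ)ˣ = ℓ′ − 1` for a finite place `ℓ` of `ℚ` (`Nℓ = ℓ′` prime). [folklore] -/
theorem natCard_units_zmod_absNorm (ℓ : HeightOneSpectrum (𝓞 ℚ)) :
    Nat.card (ZMod (Ideal.absNorm ℓ.asIdeal))ˣ = ((primesEquiv ℓ : Nat.Primes) : ℕ) - 1 := by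
  haveI : NeZero ((primesEquiv ℓ : Nat.Primes) : ℕ) := ⟨(primesEquiv ℓ).2.ne_zero⟩
  rw [Literature.NumberTheory.LFunctions.absNorm_asIdeal_eq_primesEquiv ℓ]
  exact natCard_units_zmod_eq_sub_one (primesEquiv ℓ).2

/-- `Gal(ℚ̄/ℚ(μ_{Nℓ})) = Gal(ℚ̄/ℚ(μ_{ℓ′}))` = the tame level of `cyclotomicLevelsRat p S` at `ℓ`.
[folklore] -/
theorem rootsOfUnityFixer_absNorm_eq_tameLevel (p : ℕ) [Fact p.Prime]
    (S : Set (HeightOneSpectrum (𝓞 ℚ))) (ℓ : HeightOneSpectrum (𝓞 ℚ)) :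
    rootsOfUnityFixer ℚ (Ideal.absNorm ℓ.asIdeal) = (cyclotomicLevelsRat p S).tameLevel ℓ := by
  rw [Literature.NumberTheory.LFunctions.absNorm_asIdeal_eq_primesEquiv ℓ, cyclotomicLevelsRat_tameLevel]

/-- **Generators of the cyclotomic levels chosen in the inertia groups, with prescribed characters
mod `Nℓ`** (ROW T-DER's `hσ`, `hcov`, `hinj`, `hσI`, `hσχ` at once, in the currency of
`KolyvaginDatum.HasCanonicalComparison`).  Given primes `𝔔_ℓ ∣ ℓ` of `ℤ̄` and units
`η_ℓ ∈ (ℤ/Nℓ)ˣ` for all finite places `ℓ` of `ℚ`, there is `σ : ℓ ↦ σ_ℓ ∈ Γ_ℚ` with: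
`σ_ℓ ∈ I_{𝔔_ℓ}`; `χ_{Nℓ}(σ_ℓ) = η_ℓ`; `σ_ℓ ∈ L.tameLevel q` for `q ≠ ℓ` and `σ_ℓ ∈ L.pLevel n` for
`ℓ′ ≠ p` (`L = cyclotomicLevelsRat p S`); and, at every `ℓ` where `η_ℓ` generates `(ℤ/Nℓ)ˣ`, every
`g ∈ Γ_ℚ` is `σ_ℓ^j · u` with `j < ℓ′ − 1`, `u ∈ L.tameLevel ℓ`, and `j` is unique.
Rubin, *Euler Systems* §4.4; Rubin PCMI Def. 1.9.4; Kim §2.2.2. [folklore] -/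
theorem exists_sigma_mem_inertia_absNorm (p : ℕ) [Fact p.Prime] (S : Set (HeightOneSpectrum (𝓞 ℚ)))
    (𝔔 : (ℓ : HeightOneSpectrum (𝓞 ℚ)) → Ideal (absIntegers (𝓞 ℚ) ℚ))
    (h𝔔 : ∀ ℓ, 𝔔 ℓ ∈ ℓ.primesAbove)
    (η : (ℓ : HeightOneSpectrum (𝓞 ℚ)) → (ZMod (Ideal.absNorm ℓ.asIdeal))ˣ) :
    ∃ σ : HeightOneSpectrum (𝓞 ℚ) → absoluteGaloisGroup ℚ,
      (∀ ℓ, σ ℓ ∈ (𝔔 ℓ).inertia (absoluteGaloisGroup ℚ)) ∧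
      (∀ ℓ, modNCyclotomicCharacter ℚ (Ideal.absNorm ℓ.asIdeal) (σ ℓ) = η ℓ) ∧
      (∀ ℓ q, q ≠ ℓ → σ ℓ ∈ (cyclotomicLevelsRat p S).tameLevel q) ∧
      (∀ ℓ (n : ℕ), ((primesEquiv ℓ : Nat.Primes) : ℕ) ≠ p →
        σ ℓ ∈ (cyclotomicLevelsRat p S).pLevel n) ∧
      (∀ ℓ, Subgroup.zpowers (η ℓ) = ⊤ → ∀ g : absoluteGaloisGroup ℚ,
        ∃ j < ((primesEquiv ℓ : Nat.Primes) : ℕ) - 1,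
          (σ ℓ ^ j)⁻¹ * g ∈ (cyclotomicLevelsRat p S).tameLevel ℓ) ∧
      (∀ ℓ, Subgroup.zpowers (η ℓ) = ⊤ → ∀ j₁ < ((primesEquiv ℓ : Nat.Primes) : ℕ) - 1,
        ∀ j₂ < ((primesEquiv ℓ : Nat.Primes) : ℕ) - 1,
          (σ ℓ ^ j₁)⁻¹ * σ ℓ ^ j₂ ∈ (cyclotomicLevelsRat p S).tameLevel ℓ → j₁ = j₂) := by
  choose σ hσI hσχ using fun ℓ =>
    exists_mem_inertia_modNCyclotomicCharacter_absNorm_eq ℓ (h𝔔 ℓ) (η ℓ)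
  -- generation, read on `χ_{Nℓ}(σ_ℓ)`
  have hgen : ∀ ℓ, Subgroup.zpowers (η ℓ) = ⊤ →
      ∀ x : (ZMod (Ideal.absNorm ℓ.asIdeal))ˣ, x ∈ Subgroup.zpowers
        (modNCyclotomicCharacter ℚ (Ideal.absNorm ℓ.asIdeal) (σ ℓ)) := by
    intro ℓ hη x
    rw [hσχ ℓ, hη]
    exact Subgroup.mem_top x
  refine ⟨σ, hσI, hσχ, fun ℓ q hqℓ => ?_, fun ℓ n hℓp => ?_, fun ℓ hη g => ?_,
    fun ℓ hη j₁ hj₁ j₂ hj₂ h => ?_⟩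
  · exact mem_tameLevel_of_mem_inertia p S (h𝔔 ℓ) (hσI ℓ) hqℓ
  · exact mem_pLevel_of_mem_inertia p S (h𝔔 ℓ) (hσI ℓ) hℓp n
  · -- covering
    obtain ⟨j, ⟨hj, hju⟩, -⟩ :=
      existsUnique_pow_inv_mul_mem_rootsOfUnityFixer (σ ℓ) (hgen ℓ hη) g
    rw [natCard_units_zmod_absNorm] at hj
    exact ⟨j, hj, by rw [← rootsOfUnityFixer_absNorm_eq_tameLevel p S ℓ]; exact hju⟩
  · -- uniqueness of the exponent
    rw [← rootsOfUnityFixer_absNorm_eq_tameLevel p S ℓ] at h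
    have h₂ : (σ ℓ ^ j₂)⁻¹ * σ ℓ ^ j₂ ∈ rootsOfUnityFixer ℚ (Ideal.absNorm ℓ.asIdeal) := by
      rw [inv_mul_cancel]; exact one_mem _
    rw [← natCard_units_zmod_absNorm ℓ] at hj₁ hj₂
    exact (existsUnique_pow_inv_mul_mem_rootsOfUnityFixer (σ ℓ) (hgen ℓ hη) (σ ℓ ^ j₂)).unique
      ⟨hj₁, h⟩ ⟨hj₂, h₂⟩

/-- **The same with the tree's canonical primes `𝔓₀(ℓ) = adicCompletionPrime ℚ ℓ` above every
`ℓ`** (the primes of C5a/C5b-β's `hσI`), and the INST shapes `hσ hcov hinj` packaged on every finite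
set `r` of places at which the `η_ℓ` generate. [folklore] -/
theorem exists_sigma_mem_inertia_adicCompletionPrime (p : ℕ) [Fact p.Prime]
    (S : Set (HeightOneSpectrum (𝓞 ℚ)))
    (η : (ℓ : HeightOneSpectrum (𝓞 ℚ)) → (ZMod (Ideal.absNorm ℓ.asIdeal))ˣ)
    (Pr : Set (HeightOneSpectrum (𝓞 ℚ))) (hPr : ∀ ℓ ∈ Pr, Subgroup.zpowers (η ℓ) = ⊤) :
    ∃ σ : HeightOneSpectrum (𝓞 ℚ) → absoluteGaloisGroup ℚ,
      (∀ ℓ, σ ℓ ∈ (adicCompletionPrime ℚ ℓ).inertia (absoluteGaloisGroup ℚ)) ∧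
      (∀ ℓ, modNCyclotomicCharacter ℚ (Ideal.absNorm ℓ.asIdeal) (σ ℓ) = η ℓ) ∧
      (∀ ℓ (n : ℕ), ((primesEquiv ℓ : Nat.Primes) : ℕ) ≠ p →
        σ ℓ ∈ (cyclotomicLevelsRat p S).pLevel n) ∧
      ∀ r : Finset (HeightOneSpectrum (𝓞 ℚ)), (↑r : Set _) ⊆ Pr →
        (∀ ℓ ∈ r, ∀ ℓ₂ ∈ r, ℓ₂ ≠ ℓ → σ ℓ ∈ (cyclotomicLevelsRat p S).tameLevel ℓ₂) ∧
        (∀ ℓ ∈ r, ∀ g : absoluteGaloisGroup ℚ,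
          ∃ j < ((primesEquiv ℓ : Nat.Primes) : ℕ) - 1,
            (σ ℓ ^ j)⁻¹ * g ∈ (cyclotomicLevelsRat p S).tameLevel ℓ) ∧
        (∀ ℓ ∈ r, ∀ j₁ < ((primesEquiv ℓ : Nat.Primes) : ℕ) - 1,
          ∀ j₂ < ((primesEquiv ℓ : Nat.Primes) : ℕ) - 1,
            (σ ℓ ^ j₁)⁻¹ * σ ℓ ^ j₂ ∈ (cyclotomicLevelsRat p S).tameLevel ℓ → j₁ = j₂) := by
  obtain ⟨σ, hσI, hσχ, htame, hpl, hcov, hinj⟩ := exists_sigma_mem_inertia_absNorm p S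
    (fun ℓ => adicCompletionPrime ℚ ℓ) (fun ℓ => adicCompletionPrime_mem_primesAbove ℚ ℓ) η
  exact ⟨σ, hσI, hσχ, hpl, fun r hr =>
    ⟨fun ℓ _ ℓ₂ _ hne => htame ℓ ℓ₂ hne,
      fun ℓ hℓ g => hcov ℓ (hPr ℓ (hr (Finset.mem_coe.mpr hℓ))) g,
      fun ℓ hℓ j₁ hj₁ j₂ hj₂ h => hinj ℓ (hPr ℓ (hr (Finset.mem_coe.mpr hℓ))) j₁ hj₁ j₂ hj₂ h⟩⟩

end Summit.BirchSwinnertonDyer.Rank1Residual.GaloisImage.CyclotomicLevel.Rat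

end
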